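import Literature.NumberTheory.EllipticCurves.KubertTate289CubicModel
import Literature.NumberTheory.EllipticCurves.TwoIsogenyLocalImageNodeNumberField
import Literature.NumberTheory.NumberFields.CubicField14483SelmerUnits
import HarnessLib

/-!
# `E_{28/9}` over its cubic `2`-division field: the local conditions of the `2`-isogeny descent at the odd
# multiplicative places, as quadratic-residue conditions

Topic `NumberTheory/EllipticCurves`. Continuation of `KubertTate289CubicModel.lean` (`X = E_{A,B} ≅ E_K`, `X' = E_{A',B'}`
over the cubic field `K = ℚ(γ)`, `γ³ - γ² + 27γ + 36 = 0`, `𝓞 K = ℤ[γ, δ]`). With the integral coefficients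
`A = 76 - 228γ - 219δ`, `B = -152521 - 158036γ + 88849δ`, `B' = A² - 4B = -463078 + 158036γ - 88849δ`
(`(B) = 𝔮₂⁹𝔭₃a⁵𝔭₃b⁵𝔭₇⁵𝔭₂₀₆₉`, `(B') = 𝔭₂¹⁸𝔭₃c¹⁰𝔮₇⁵𝔮₂₀₆₉`) the curves `X' : Y² = X((X - A)² - 4B)` and
`X : y² = x((x + A/2)² - B'/4)` are NODAL (multiplicative, the non-`T` two-torsion colliding) at the places dividing `B`,
resp. `B'`, and the tree's nodal kill theorem (`WeierstrassCurve.residue_sq_or_of_sqClass_mem_range_node`, Silverman *AEC*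
X.4.9) turns the local conditions of the two Selmer groups there into quadratic-residue conditions on `d ∈ 𝓞 K`:

* §1 `sq_residue_X'_of_local` / `sq_residue_X_of_local` — the generic statements for this pair of curves at a place
  `v = ker φ`, `φ : 𝓞 K → ℤ/ℓ`: `[d]_v ∈ α(X'(K_v))` with `φ(A) ≠ 0 = φ(4B)` gives `φ(d) = r²` or `φ(d)φ(A) = r²`;
  `[d]_v ∈ α(X(K_v))` with `φ(A) ≠ 0 = φ(B')`, `ℓ ≠ 2`, gives `φ(d) = r²` or `φ(d)φ(A)φ(-2) = r²`.
* §2 **the four kill places of `S^{(φ)}`** (local curve `X'`): `𝔭₃a = (3, δ)`, `𝔭₃b = (3, δ - 1)`, `𝔭₇ = (7, γ - 1)`,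
  where `φ(A) ∈ {1, 1, 4}` is a square, and `𝔭₂₀₆₉ = (2069, γ - 1278)`, where `φ(A) = 1896` is a non-residue but
  `ord(4B) = 1` is odd (`log_valuation_eq_neg_one_of_not_sq_dvd`): in all four, **`φ(d)` is a non-zero square**.
* §3 **the three odd kill places of `S^{(φ̂)}`** (local curve `X`): `𝔭₃c = (3, δ - 2)`, `𝔮₇ = (7, γ - 6)`
  (`-A/2 ↦ 1, 4`, squares) and `𝔮₂₀₆₉ = (2069, γ - 1583)` (`ord(B') = 1`): again `φ(d)` is a non-zero square.

Everything is proved; theorems only. The dyadic place `𝔭₂` (for `S^{(φ̂)}`) and the assembly are in sequel files.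

## References
* [SilvermanAEC2009] J. H. Silverman, *The Arithmetic of Elliptic Curves*, 2nd ed. (2009), Prop. X.4.9, Ex. X.4.10.
* [Marcus2018] D. A. Marcus, *Number Fields*, 2nd ed. (2018), Ch. 3 Thm. 22 and 27 (prime ideals, norms).
-/

noncomputable section

open scoped Classical NumberField
open Polynomial Module NumberField Ideal IsDedekindDomain

namespace Literature.NumberTheory.EllipticCurves

namespace KubertTate289Cubic

open _root_.WeierstrassCurve _root_.WeierstrassCurve.Affine
open Literature.NumberTheory.NumberFields Literature.NumberTheory.NumberFields.MonicCubic
open Literature.NumberTheory.NumberFields.CubicField14483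

variable {K : Type*} [Field K] [NumberField K] {γ : K}

/-! ## §0 The integral coefficients `A`, `B`, `B'` -/

/-- `A = 76 - 228γ - 219δ = -73γ² - 155γ - 1238`. [cite: SilvermanAEC2009, Prop. X.4.9] -/
theorem coe_Aint (hγ : γ ^ 3 - γ ^ 2 + 27 * γ + 36 = 0) :
    algebraMap (𝓞 K) K (((76 : ℤ) : 𝓞 K) + (-228 : ℤ) * thetaInt (aeval_eq hγ) + (-219 : ℤ) * thetaInt (delta_root hγ)) =
      (-73 * γ ^ 2 - 155 * γ - 1238 : K) := by
  rw [← RingOfIntegers.coe_eq_algebraMap, coe_lin hγ]; push_cast; ring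

/-- `B = -152521 - 158036γ + 88849δ = (88849γ² - 562957γ + 1141719)/3`. [cite: SilvermanAEC2009, Prop. X.4.9] -/
theorem coe_Bint (hγ : γ ^ 3 - γ ^ 2 + 27 * γ + 36 = 0) :
    algebraMap (𝓞 K) K (((-152521 : ℤ) : 𝓞 K) + (-158036 : ℤ) * thetaInt (aeval_eq hγ) +
        (88849 : ℤ) * thetaInt (delta_root hγ)) = ((88849 * γ ^ 2 - 562957 * γ + 1141719) / 3 : K) := by
  rw [← RingOfIntegers.coe_eq_algebraMap, coe_lin hγ]; push_cast; ring

/-- `B' = -463078 + 158036γ - 88849δ = (-88849γ² + 562957γ - 2988516)/3`. [cite: SilvermanAEC2009, Prop. X.4.9] -/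
theorem coe_Bpint (hγ : γ ^ 3 - γ ^ 2 + 27 * γ + 36 = 0) :
    algebraMap (𝓞 K) K (((-463078 : ℤ) : 𝓞 K) + (158036 : ℤ) * thetaInt (aeval_eq hγ) +
        (-88849 : ℤ) * thetaInt (delta_root hγ)) = ((-88849 * γ ^ 2 + 562957 * γ - 2988516) / 3 : K) := by
  rw [← RingOfIntegers.coe_eq_algebraMap, coe_lin hγ]; push_cast; ring

/-! ## §1 The nodal kill theorem specialised to `X'` and to `X` -/

/-- **Local condition of `S^{(φ)}(X/K)` at a nodal place of `X'`.** For `φ : 𝓞 K → ℤ/ℓ` with `φ(A) ≠ 0`, `φ(4B) = 0`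
and `d ∈ 𝓞 K` with `φ(d) ≠ 0`: if `[d]_v ∈ α(X'(K_v))` at `v = ker φ`, then `φ(d) = r²` or `φ(d) φ(A) = r²` with `r ≠ 0`
(`X' : Y² = X((X - A)² - 4B)`). [cite: SilvermanAEC2009, Prop. X.4.9] -/
theorem sq_residue_X'_of_local (hγ : γ ^ 3 - γ ^ 2 + 27 * γ + 36 = 0) {ℓ : ℕ} [Fact ℓ.Prime] (φ : 𝓞 K →+* ZMod ℓ)
    (hA : φ (((76 : ℤ) : 𝓞 K) + (-228 : ℤ) * thetaInt (aeval_eq hγ) + (-219 : ℤ) * thetaInt (delta_root hγ)) ≠ 0)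
    (h4B : φ (4 * (((-152521 : ℤ) : 𝓞 K) + (-158036 : ℤ) * thetaInt (aeval_eq hγ) +
      (88849 : ℤ) * thetaInt (delta_root hγ))) = 0)
    (v : HeightOneSpectrum (𝓞 K)) (hv : RingHom.ker φ = v.asIdeal)
    {d : 𝓞 K} (hd : φ d ≠ 0)
    (hloc : sqClass (algebraMap K (v.adicCompletion K) (algebraMap (𝓞 K) K d)) ∈
      Set.range ((⟨0, 146 * γ ^ 2 + 310 * γ + 2476, 0, (-88849 * γ ^ 2 + 562957 * γ - 2988516) / 3, 0⟩ :
        WeierstrassCurve K).baseChange (v.adicCompletion K)).xSqClass) :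
    ∃ r : ZMod ℓ, r ≠ 0 ∧ (φ d = r ^ 2 ∨
      φ d * φ (((76 : ℤ) : 𝓞 K) + (-228 : ℤ) * thetaInt (aeval_eq hγ) + (-219 : ℤ) * thetaInt (delta_root hγ)) =
        r ^ 2) := by
  have key := residue_sq_or_of_sqClass_mem_range_node φ (ZMod.ringHom_surjective φ) v hv
    (⟨0, 146 * γ ^ 2 + 310 * γ + 2476, 0, (-88849 * γ ^ 2 + 562957 * γ - 2988516) / 3, 0⟩ : WeierstrassCurve K)
    (c := (-73 * γ ^ 2 - 155 * γ - 1238 : K)) (e := 4 * ((88849 * γ ^ 2 - 562957 * γ + 1141719) / 3 : K))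
    (by simp only; ring) (by simp only; rw [← sq_sub_four_mul_eq hγ]) (n := 1)
    (c₀ := ((76 : ℤ) : 𝓞 K) + (-228 : ℤ) * thetaInt (aeval_eq hγ) + (-219 : ℤ) * thetaInt (delta_root hγ))
    (e₀ := 4 * (((-152521 : ℤ) : 𝓞 K) + (-158036 : ℤ) * thetaInt (aeval_eq hγ) + (88849 : ℤ) * thetaInt (delta_root hγ)))
    (by rw [coe_Aint hγ]; push_cast; ring) (by rw [map_mul, map_ofNat, coe_Bint hγ]; ring)
    (by rw [← hv, show ((1 : ℤ) : 𝓞 K) = 1 from Int.cast_one, RingHom.mem_ker, map_one]; exact one_ne_zero)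
    (by rw [← hv, RingHom.mem_ker]; exact hA)
    (by rw [← hv, RingHom.mem_ker]; exact h4B)
    (d := d) (by rw [← hv, RingHom.mem_ker]; exact hd) hloc
  obtain ⟨r, hr, h⟩ := key
  refine ⟨r, hr.ne_zero, ?_⟩
  rcases h with h | h
  · exact Or.inl h
  · right; rw [show ((1 : ℤ) : 𝓞 K) = 1 from Int.cast_one, map_one, mul_one] at h; exact h

/-- **Local condition of `S^{(φ̂)}` at a nodal place of `X`.** For `φ : 𝓞 K → ℤ/ℓ` with `φ(-2) ≠ 0`, `φ(A) ≠ 0`,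
`φ(B') = 0` and `φ(d) ≠ 0`: if `[d]_v ∈ α(X(K_v))` at `v = ker φ`, then `φ(d) = r²` or `φ(d) φ(A) φ(-2) = r²` with
`r ≠ 0` (`X : y² = x((x + A/2)² - B'/4)`, `c = -A/2`, `n = -2`). [cite: SilvermanAEC2009, Prop. X.4.9] -/
theorem sq_residue_X_of_local (hγ : γ ^ 3 - γ ^ 2 + 27 * γ + 36 = 0) {ℓ : ℕ} [Fact ℓ.Prime] (φ : 𝓞 K →+* ZMod ℓ)
    (h2 : φ ((-2 : ℤ) : 𝓞 K) ≠ 0)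
    (hA : φ (((76 : ℤ) : 𝓞 K) + (-228 : ℤ) * thetaInt (aeval_eq hγ) + (-219 : ℤ) * thetaInt (delta_root hγ)) ≠ 0)
    (hBp : φ (((-463078 : ℤ) : 𝓞 K) + (158036 : ℤ) * thetaInt (aeval_eq hγ) +
      (-88849 : ℤ) * thetaInt (delta_root hγ)) = 0)
    (v : HeightOneSpectrum (𝓞 K)) (hv : RingHom.ker φ = v.asIdeal)
    {d : 𝓞 K} (hd : φ d ≠ 0)
    (hloc : sqClass (algebraMap K (v.adicCompletion K) (algebraMap (𝓞 K) K d)) ∈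
      Set.range ((⟨0, -73 * γ ^ 2 - 155 * γ - 1238, 0, (88849 * γ ^ 2 - 562957 * γ + 1141719) / 3, 0⟩ :
        WeierstrassCurve K).baseChange (v.adicCompletion K)).xSqClass) :
    ∃ r : ZMod ℓ, r ≠ 0 ∧ (φ d = r ^ 2 ∨
      φ d * φ (((76 : ℤ) : 𝓞 K) + (-228 : ℤ) * thetaInt (aeval_eq hγ) + (-219 : ℤ) * thetaInt (delta_root hγ)) *
        φ ((-2 : ℤ) : 𝓞 K) = r ^ 2) := by
  have h20 : (2 : K) ≠ 0 := two_ne_zero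
  have key := residue_sq_or_of_sqClass_mem_range_node φ (ZMod.ringHom_surjective φ) v hv
    (⟨0, -73 * γ ^ 2 - 155 * γ - 1238, 0, (88849 * γ ^ 2 - 562957 * γ + 1141719) / 3, 0⟩ : WeierstrassCurve K)
    (c := -(-73 * γ ^ 2 - 155 * γ - 1238 : K) / 2)
    (e := (-73 * γ ^ 2 - 155 * γ - 1238 : K) ^ 2 / 4 - (88849 * γ ^ 2 - 562957 * γ + 1141719) / 3)
    (by simp only; field_simp) (by simp only; field_simp; ring) (n := -2)
    (c₀ := ((76 : ℤ) : 𝓞 K) + (-228 : ℤ) * thetaInt (aeval_eq hγ) + (-219 : ℤ) * thetaInt (delta_root hγ))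
    (e₀ := ((-463078 : ℤ) : 𝓞 K) + (158036 : ℤ) * thetaInt (aeval_eq hγ) + (-88849 : ℤ) * thetaInt (delta_root hγ))
    (by rw [coe_Aint hγ]; push_cast; field_simp)
    (by rw [coe_Bpint hγ, ← sq_sub_four_mul_eq hγ]; push_cast; field_simp; ring)
    (by rw [← hv, RingHom.mem_ker]; exact h2)
    (by rw [← hv, RingHom.mem_ker]; exact hA)
    (by rw [← hv, RingHom.mem_ker]; exact hBp)
    (d := d) (by rw [← hv, RingHom.mem_ker]; exact hd) hloc
  obtain ⟨r, hr, h⟩ := key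
  exact ⟨r, hr.ne_zero, h⟩

/-! ## §2 Odd order of `4B` at `𝔭₂₀₆₉` and of `B'` at `𝔮₂₀₆₉` -/

/-- **`ord_v(x) = 1` from `x ∈ v` and `ℓ² ∤ |N(x)|`** (`v = ker φ` of norm `ℓ`): `x ∈ v²` would give
`ℓ² = N(v²) ∣ N((x)) = |N(x)|`. [cite: Marcus2018, Ch. 3, Thm. 22] -/
theorem log_valuation_eq_neg_one_of_not_sq_dvd {ℓ : ℕ} [Fact ℓ.Prime] (φ : 𝓞 K →+* ZMod ℓ)
    (v : HeightOneSpectrum (𝓞 K)) (hv : RingHom.ker φ = v.asIdeal) {x : 𝓞 K}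
    (hx : φ x = 0) (hN : ¬ ℓ ^ 2 ∣ (Algebra.norm ℤ x).natAbs) :
    WithZero.log (v.valuation K (algebraMap (𝓞 K) K x)) = -1 := by
  have hx0 : x ≠ 0 := by
    intro h0; apply hN; rw [h0, Algebra.norm_zero, Int.natAbs_zero]; exact dvd_zero _
  have h1 : WithZero.log (v.valuation K (x : K)) ≤ -((1 : ℕ) : ℤ) := by
    rw [← mem_pow_iff_log_valuation_le v hx0, pow_one, ← hv]; exact (RingHom.mem_ker).mpr hx
  have h2 : ¬ WithZero.log (v.valuation K (x : K)) ≤ -((2 : ℕ) : ℤ) := by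
    rw [← mem_pow_iff_log_valuation_le v hx0]
    intro hmem
    apply hN
    have hdvd := Ideal.absNorm_dvd_absNorm_of_le ((Ideal.span_singleton_le_iff_mem _).mpr hmem)
    rwa [map_pow, ← hv, absNorm_ker_zmod φ, Ideal.absNorm_span_singleton] at hdvd
  rw [← RingOfIntegers.coe_eq_algebraMap]
  push_cast at h1 h2
  omega

/-- The residue map `φ : 𝓞 K → ℤ/2069` with `φ(γ) = r` has `φ(δ) = 690 (r² - r + 18)` (`3·690 ≡ 1`).
[cite: Marcus2018, Ch. 3, Thm. 27] -/
theorem residueHom_2069_delta (hγ : γ ^ 3 - γ ^ 2 + 27 * γ + 36 = 0) (φ : 𝓞 K →+* ZMod 2069) (r : ZMod 2069)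
    (hφγ : φ (thetaInt (aeval_eq hγ)) = r) : φ (thetaInt (delta_root hγ)) = 690 * (r ^ 2 - r + 18) := by
  have h3 : (690 : ZMod 2069) * 3 = 1 := by decide
  have h := congrArg φ (three_delta hγ)
  rw [map_mul, map_ofNat, map_add, map_sub, map_pow, map_ofNat, hφγ] at h
  calc φ (thetaInt (delta_root hγ)) = 690 * (3 * φ (thetaInt (delta_root hγ))) := by rw [← mul_assoc, h3, one_mul]
    _ = 690 * (r ^ 2 - r + 18) := by rw [h]

/-- The residue map `φ : 𝓞 K → ℤ/7` with `φ(γ) = r` has `φ(δ) = 5(r² - r + 18)` (`3·5 ≡ 1`). [cite: Marcus2018, Ch. 3, Thm. 27] -/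
theorem residueHom_seven_delta (hγ : γ ^ 3 - γ ^ 2 + 27 * γ + 36 = 0) (φ : 𝓞 K →+* ZMod 7) (r : ZMod 7)
    (hφγ : φ (thetaInt (aeval_eq hγ)) = r) : φ (thetaInt (delta_root hγ)) = 5 * (r ^ 2 - r + 18) := by
  have h3 : (5 : ZMod 7) * 3 = 1 := by decide
  have h := congrArg φ (three_delta hγ)
  rw [map_mul, map_ofNat, map_add, map_sub, map_pow, map_ofNat, hφγ] at h
  calc φ (thetaInt (delta_root hγ)) = 5 * (3 * φ (thetaInt (delta_root hγ))) := by rw [← mul_assoc, h3, one_mul]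
    _ = 5 * (r ^ 2 - r + 18) := by rw [h]

/-- **`ord_{𝔭₂₀₆₉}(4B) = 1`** (`𝔭₂₀₆₉ = (2069, γ - 1278)`: `4B ∈ 𝔭₂₀₆₉`, `|N(4B)| = 2⁶·2¹⁸3¹⁰7⁵·2069` is not divisible
by `2069²`). [cite: Marcus2018, Ch. 3, Thm. 22] -/
theorem log_valuation_p2069_fourB (hγ : γ ^ 3 - γ ^ 2 + 27 * γ + 36 = 0) (h3 : finrank ℚ K = 3)
    (φ : 𝓞 K →+* ZMod 2069) (hφγ : φ (thetaInt (aeval_eq hγ)) = 1278) (v : HeightOneSpectrum (𝓞 K))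
    (hv : RingHom.ker φ = v.asIdeal) :
    WithZero.log (v.valuation K (algebraMap (𝓞 K) K (4 * (((-152521 : ℤ) : 𝓞 K) + (-158036 : ℤ) * thetaInt (aeval_eq hγ) + (88849 : ℤ) * thetaInt (delta_root hγ))))) = -1 := by
  have eδ : (690 : ZMod 2069) * (1278 ^ 2 - 1278 + 18) = 1930 := by decide
  have ex : (4 : ZMod 2069) * (((-152521 : ℤ) : ZMod 2069) + ((-158036 : ℤ) : ZMod 2069) * 1278 +
      ((88849 : ℤ) : ZMod 2069) * 1930) = 0 := by decide
  haveI : Fact (Nat.Prime 2069) := ⟨by norm_num⟩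
  have hδ : φ (thetaInt (delta_root hγ)) = 1930 := by rw [residueHom_2069_delta hγ φ 1278 hφγ]; exact eδ
  have hx : φ (4 * (((-152521 : ℤ) : 𝓞 K) + (-158036 : ℤ) * thetaInt (aeval_eq hγ) + (88849 : ℤ) * thetaInt (delta_root hγ))) = 0 := by
    simp only [map_mul, map_add, map_ofNat, map_intCast, hφγ, hδ]; exact ex
  refine log_valuation_eq_neg_one_of_not_sq_dvd φ v hv hx ?_
  have h4 : (4 : 𝓞 K) * (((-152521 : ℤ) : 𝓞 K) + (-158036 : ℤ) * thetaInt (aeval_eq hγ) + (88849 : ℤ) * thetaInt (delta_root hγ)) = ((-610084 : ℤ) : 𝓞 K) + (-632144 : ℤ) * thetaInt (aeval_eq hγ) +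
        (355396 : ℤ) * thetaInt (delta_root hγ) := by push_cast; ring
  rw [h4, norm_lin3 hγ h3]; norm_num

/-- **`ord_{𝔮₂₀₆₉}(B') = 1`** (`𝔮₂₀₆₉ = (2069, γ - 1583)`: `B' ∈ 𝔮₂₀₆₉`, `|N(B')| = 2¹⁸3¹⁰7⁵·2069`).
[cite: Marcus2018, Ch. 3, Thm. 22] -/
theorem log_valuation_q2069_Bp (hγ : γ ^ 3 - γ ^ 2 + 27 * γ + 36 = 0) (h3 : finrank ℚ K = 3)
    (φ : 𝓞 K →+* ZMod 2069) (hφγ : φ (thetaInt (aeval_eq hγ)) = 1583) (v : HeightOneSpectrum (𝓞 K))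
    (hv : RingHom.ker φ = v.asIdeal) :
    WithZero.log (v.valuation K (algebraMap (𝓞 K) K (((-463078 : ℤ) : 𝓞 K) + (158036 : ℤ) * thetaInt (aeval_eq hγ) + (-88849 : ℤ) * thetaInt (delta_root hγ)))) = -1 := by
  have eδ : (690 : ZMod 2069) * (1583 ^ 2 - 1583 + 18) = 278 := by decide
  have ex : ((-463078 : ℤ) : ZMod 2069) + ((158036 : ℤ) : ZMod 2069) * 1583 + ((-88849 : ℤ) : ZMod 2069) * 278 = 0 := by
    decide
  haveI : Fact (Nat.Prime 2069) := ⟨by norm_num⟩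
  have hδ : φ (thetaInt (delta_root hγ)) = 278 := by rw [residueHom_2069_delta hγ φ 1583 hφγ]; exact eδ
  have hx : φ (((-463078 : ℤ) : 𝓞 K) + (158036 : ℤ) * thetaInt (aeval_eq hγ) + (-88849 : ℤ) * thetaInt (delta_root hγ)) = 0 := by
    simp only [map_add, map_mul, map_intCast, hφγ, hδ]; exact ex
  refine log_valuation_eq_neg_one_of_not_sq_dvd φ v hv hx ?_
  rw [norm_lin3 hγ h3]; norm_num

/-! ## §3 The four kill places of `S^{(φ)}(X/K)`: `φ(d)` is a non-zero square -/

/-- **At `𝔭₃a = (3, δ)` (`γ ↦ 1`, `δ ↦ 0`; `A ↦ 1`, `4B ↦ 0`): `φ(d)` is a non-zero square.**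
[cite: SilvermanAEC2009, Prop. X.4.9] -/
theorem sq_residue_p3a (hγ : γ ^ 3 - γ ^ 2 + 27 * γ + 36 = 0) (φ : 𝓞 K →+* ZMod 3)
    (hφγ : φ (thetaInt (aeval_eq hγ)) = 1) (hφδ : φ (thetaInt (delta_root hγ)) = 0)
    (v : HeightOneSpectrum (𝓞 K)) (hv : RingHom.ker φ = v.asIdeal) {d : 𝓞 K} (hd : φ d ≠ 0)
    (hloc : sqClass (algebraMap K (v.adicCompletion K) (algebraMap (𝓞 K) K d)) ∈
      Set.range ((⟨0, 146 * γ ^ 2 + 310 * γ + 2476, 0, (-88849 * γ ^ 2 + 562957 * γ - 2988516) / 3, 0⟩ : WeierstrassCurve K).baseChange (v.adicCompletion K)).xSqClass) :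
    ∃ r : ZMod 3, r ≠ 0 ∧ φ d = r ^ 2 := by
  have eA : ((76 : ℤ) : ZMod 3) + ((-228 : ℤ) : ZMod 3) * 1 + ((-219 : ℤ) : ZMod 3) * 0 = 1 := by decide
  have eB : (4 : ZMod 3) * (((-152521 : ℤ) : ZMod 3) + ((-158036 : ℤ) : ZMod 3) * 1 + ((88849 : ℤ) : ZMod 3) * 0) = 0 := by
    decide
  have hA : φ (((76 : ℤ) : 𝓞 K) + (-228 : ℤ) * thetaInt (aeval_eq hγ) + (-219 : ℤ) * thetaInt (delta_root hγ)) = 1 := by simp only [map_add, map_mul, map_intCast, hφγ, hφδ]; exact eA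
  have h4B : φ (4 * (((-152521 : ℤ) : 𝓞 K) + (-158036 : ℤ) * thetaInt (aeval_eq hγ) + (88849 : ℤ) * thetaInt (delta_root hγ))) = 0 := by simp only [map_mul, map_add, map_ofNat, map_intCast, hφγ, hφδ]; exact eB
  obtain ⟨r, hr, h⟩ := sq_residue_X'_of_local hγ φ (by rw [hA]; exact one_ne_zero) h4B v hv hd hloc
  rw [hA, mul_one, or_self] at h
  exact ⟨r, hr, h⟩

/-- **At `𝔭₃b = (3, δ - 1)` (`γ ↦ 0`, `δ ↦ 1`; `A ↦ 1`, `4B ↦ 0`): `φ(d)` is a non-zero square.**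
[cite: SilvermanAEC2009, Prop. X.4.9] -/
theorem sq_residue_p3b (hγ : γ ^ 3 - γ ^ 2 + 27 * γ + 36 = 0) (φ : 𝓞 K →+* ZMod 3)
    (hφγ : φ (thetaInt (aeval_eq hγ)) = 0) (hφδ : φ (thetaInt (delta_root hγ)) = 1)
    (v : HeightOneSpectrum (𝓞 K)) (hv : RingHom.ker φ = v.asIdeal) {d : 𝓞 K} (hd : φ d ≠ 0)
    (hloc : sqClass (algebraMap K (v.adicCompletion K) (algebraMap (𝓞 K) K d)) ∈
      Set.range ((⟨0, 146 * γ ^ 2 + 310 * γ + 2476, 0, (-88849 * γ ^ 2 + 562957 * γ - 2988516) / 3, 0⟩ : WeierstrassCurve K).baseChange (v.adicCompletion K)).xSqClass) :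
    ∃ r : ZMod 3, r ≠ 0 ∧ φ d = r ^ 2 := by
  have eA : ((76 : ℤ) : ZMod 3) + ((-228 : ℤ) : ZMod 3) * 0 + ((-219 : ℤ) : ZMod 3) * 1 = 1 := by decide
  have eB : (4 : ZMod 3) * (((-152521 : ℤ) : ZMod 3) + ((-158036 : ℤ) : ZMod 3) * 0 + ((88849 : ℤ) : ZMod 3) * 1) = 0 := by
    decide
  have hA : φ (((76 : ℤ) : 𝓞 K) + (-228 : ℤ) * thetaInt (aeval_eq hγ) + (-219 : ℤ) * thetaInt (delta_root hγ)) = 1 := by simp only [map_add, map_mul, map_intCast, hφγ, hφδ]; exact eA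
  have h4B : φ (4 * (((-152521 : ℤ) : 𝓞 K) + (-158036 : ℤ) * thetaInt (aeval_eq hγ) + (88849 : ℤ) * thetaInt (delta_root hγ))) = 0 := by simp only [map_mul, map_add, map_ofNat, map_intCast, hφγ, hφδ]; exact eB
  obtain ⟨r, hr, h⟩ := sq_residue_X'_of_local hγ φ (by rw [hA]; exact one_ne_zero) h4B v hv hd hloc
  rw [hA, mul_one, or_self] at h
  exact ⟨r, hr, h⟩

/-- **At `𝔭₇ = (7, γ - 1)` (`δ ↦ 6`; `A ↦ 4 = 2²`, `4B ↦ 0`): `φ(d)` is a non-zero square.**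
[cite: SilvermanAEC2009, Prop. X.4.9] -/
theorem sq_residue_p7 (hγ : γ ^ 3 - γ ^ 2 + 27 * γ + 36 = 0) (φ : 𝓞 K →+* ZMod 7)
    (hφγ : φ (thetaInt (aeval_eq hγ)) = 1)
    (v : HeightOneSpectrum (𝓞 K)) (hv : RingHom.ker φ = v.asIdeal) {d : 𝓞 K} (hd : φ d ≠ 0)
    (hloc : sqClass (algebraMap K (v.adicCompletion K) (algebraMap (𝓞 K) K d)) ∈
      Set.range ((⟨0, 146 * γ ^ 2 + 310 * γ + 2476, 0, (-88849 * γ ^ 2 + 562957 * γ - 2988516) / 3, 0⟩ : WeierstrassCurve K).baseChange (v.adicCompletion K)).xSqClass) :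
    ∃ r : ZMod 7, r ≠ 0 ∧ φ d = r ^ 2 := by
  have eδ : (5 : ZMod 7) * (1 ^ 2 - 1 + 18) = 6 := by decide
  have eA : ((76 : ℤ) : ZMod 7) + ((-228 : ℤ) : ZMod 7) * 1 + ((-219 : ℤ) : ZMod 7) * 6 = 4 := by decide
  have eB : (4 : ZMod 7) * (((-152521 : ℤ) : ZMod 7) + ((-158036 : ℤ) : ZMod 7) * 1 + ((88849 : ℤ) : ZMod 7) * 6) = 0 := by
    decide
  have e4 : (4 : ZMod 7) ≠ 0 := by decide
  have fin : ∀ x r : ZMod 7, r ≠ 0 → (x = r ^ 2 ∨ x * 4 = r ^ 2) → ∃ r' : ZMod 7, r' ≠ 0 ∧ x = r' ^ 2 := by decide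
  haveI : Fact (Nat.Prime 7) := ⟨by norm_num⟩
  have hδ : φ (thetaInt (delta_root hγ)) = 6 := by rw [residueHom_seven_delta hγ φ 1 hφγ]; exact eδ
  have hA : φ (((76 : ℤ) : 𝓞 K) + (-228 : ℤ) * thetaInt (aeval_eq hγ) + (-219 : ℤ) * thetaInt (delta_root hγ)) = 4 := by simp only [map_add, map_mul, map_intCast, hφγ, hδ]; exact eA
  have h4B : φ (4 * (((-152521 : ℤ) : 𝓞 K) + (-158036 : ℤ) * thetaInt (aeval_eq hγ) + (88849 : ℤ) * thetaInt (delta_root hγ))) = 0 := by simp only [map_mul, map_add, map_ofNat, map_intCast, hφγ, hδ]; exact eB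
  obtain ⟨r, hr, h⟩ := sq_residue_X'_of_local hγ φ (by rw [hA]; exact e4) h4B v hv hd hloc
  rw [hA] at h
  exact fin _ r hr h

/-- **At `𝔭₂₀₆₉ = (2069, γ - 1278)` (`A ↦ 1896`, a non-residue, but `ord(4B) = 1` is odd): `φ(d)` is a non-zero
square.** [cite: SilvermanAEC2009, Prop. X.4.9] -/
theorem sq_residue_p2069 (hγ : γ ^ 3 - γ ^ 2 + 27 * γ + 36 = 0) (h3 : finrank ℚ K = 3) (φ : 𝓞 K →+* ZMod 2069)
    (hφγ : φ (thetaInt (aeval_eq hγ)) = 1278)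
    (v : HeightOneSpectrum (𝓞 K)) (hv : RingHom.ker φ = v.asIdeal) {d : 𝓞 K} (hd : φ d ≠ 0)
    (hloc : sqClass (algebraMap K (v.adicCompletion K) (algebraMap (𝓞 K) K d)) ∈
      Set.range ((⟨0, 146 * γ ^ 2 + 310 * γ + 2476, 0, (-88849 * γ ^ 2 + 562957 * γ - 2988516) / 3, 0⟩ : WeierstrassCurve K).baseChange (v.adicCompletion K)).xSqClass) :
    ∃ r : ZMod 2069, r ≠ 0 ∧ φ d = r ^ 2 := by
  have eδ : (690 : ZMod 2069) * (1278 ^ 2 - 1278 + 18) = 1930 := by decide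
  have eA : ((76 : ℤ) : ZMod 2069) + ((-228 : ℤ) : ZMod 2069) * 1278 + ((-219 : ℤ) : ZMod 2069) * 1930 = 1896 := by decide
  have eA0 : (1896 : ZMod 2069) ≠ 0 := by decide
  have eB : (4 : ZMod 2069) * (((-152521 : ℤ) : ZMod 2069) + ((-158036 : ℤ) : ZMod 2069) * 1278 +
      ((88849 : ℤ) : ZMod 2069) * 1930) = 0 := by decide
  have em1 : ¬ (2 : ℤ) ∣ -1 := by decide
  haveI : Fact (Nat.Prime 2069) := ⟨by norm_num⟩
  have hδ : φ (thetaInt (delta_root hγ)) = 1930 := by rw [residueHom_2069_delta hγ φ 1278 hφγ]; exact eδ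
  have hA : φ (((76 : ℤ) : 𝓞 K) + (-228 : ℤ) * thetaInt (aeval_eq hγ) + (-219 : ℤ) * thetaInt (delta_root hγ)) = 1896 := by simp only [map_add, map_mul, map_intCast, hφγ, hδ]; exact eA
  have h4B : φ (4 * (((-152521 : ℤ) : 𝓞 K) + (-158036 : ℤ) * thetaInt (aeval_eq hγ) + (88849 : ℤ) * thetaInt (delta_root hγ))) = 0 := by simp only [map_mul, map_add, map_ofNat, map_intCast, hφγ, hδ]; exact eB
  have hodd : ¬ (2 : ℤ) ∣ WithZero.log (v.valuation K (algebraMap (𝓞 K) K (4 * (((-152521 : ℤ) : 𝓞 K) + (-158036 : ℤ) * thetaInt (aeval_eq hγ) + (88849 : ℤ) * thetaInt (delta_root hγ))))) := by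
    rw [log_valuation_p2069_fourB hγ h3 φ hφγ v hv]; exact em1
  have key := residue_sq_of_sqClass_mem_range_node_of_odd φ (ZMod.ringHom_surjective φ) v hv
    (⟨0, 146 * γ ^ 2 + 310 * γ + 2476, 0, (-88849 * γ ^ 2 + 562957 * γ - 2988516) / 3, 0⟩ : WeierstrassCurve K)
    (c := (-73 * γ ^ 2 - 155 * γ - 1238 : K)) (e := 4 * ((88849 * γ ^ 2 - 562957 * γ + 1141719) / 3 : K))
    (by simp only; ring) (by simp only; rw [← sq_sub_four_mul_eq hγ]) (n := 1)
    (c₀ := (((76 : ℤ) : 𝓞 K) + (-228 : ℤ) * thetaInt (aeval_eq hγ) + (-219 : ℤ) * thetaInt (delta_root hγ)))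
    (e₀ := 4 * (((-152521 : ℤ) : 𝓞 K) + (-158036 : ℤ) * thetaInt (aeval_eq hγ) + (88849 : ℤ) * thetaInt (delta_root hγ)))
    (by rw [coe_Aint hγ]; push_cast; ring) (by rw [map_mul, map_ofNat, coe_Bint hγ]; ring)
    (by rw [← hv, show ((1 : ℤ) : 𝓞 K) = 1 from Int.cast_one, RingHom.mem_ker, map_one]; exact one_ne_zero)
    (by rw [← hv, RingHom.mem_ker, hA]; exact eA0)
    (by rw [← hv, RingHom.mem_ker]; exact h4B)
    hodd (d := d) (by rw [← hv, RingHom.mem_ker]; exact hd) hloc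
  obtain ⟨r, hr, h⟩ := key
  exact ⟨r, hr.ne_zero, h⟩

/-! ## §4 The three odd kill places of `S^{(φ̂)}`: `φ(d)` is a non-zero square -/

/-- **At `𝔭₃c = (3, δ - 2)` (`γ ↦ 0`, `δ ↦ 2`; `A ↦ 1`, `-2 ↦ 1`, `B' ↦ 0`): `φ(d)` is a non-zero square.**
[cite: SilvermanAEC2009, Prop. X.4.9] -/
theorem sq_residue_p3c (hγ : γ ^ 3 - γ ^ 2 + 27 * γ + 36 = 0) (φ : 𝓞 K →+* ZMod 3)
    (hφγ : φ (thetaInt (aeval_eq hγ)) = 0) (hφδ : φ (thetaInt (delta_root hγ)) = 2)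
    (v : HeightOneSpectrum (𝓞 K)) (hv : RingHom.ker φ = v.asIdeal) {d : 𝓞 K} (hd : φ d ≠ 0)
    (hloc : sqClass (algebraMap K (v.adicCompletion K) (algebraMap (𝓞 K) K d)) ∈
      Set.range ((⟨0, -73 * γ ^ 2 - 155 * γ - 1238, 0, (88849 * γ ^ 2 - 562957 * γ + 1141719) / 3, 0⟩ : WeierstrassCurve K).baseChange (v.adicCompletion K)).xSqClass) :
    ∃ r : ZMod 3, r ≠ 0 ∧ φ d = r ^ 2 := by
  have eA : ((76 : ℤ) : ZMod 3) + ((-228 : ℤ) : ZMod 3) * 0 + ((-219 : ℤ) : ZMod 3) * 2 = 1 := by decide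
  have eB : ((-463078 : ℤ) : ZMod 3) + ((158036 : ℤ) : ZMod 3) * 0 + ((-88849 : ℤ) : ZMod 3) * 2 = 0 := by decide
  have e2 : ((-2 : ℤ) : ZMod 3) = 1 := by decide
  have hA : φ (((76 : ℤ) : 𝓞 K) + (-228 : ℤ) * thetaInt (aeval_eq hγ) + (-219 : ℤ) * thetaInt (delta_root hγ)) = 1 := by simp only [map_add, map_mul, map_intCast, hφγ, hφδ]; exact eA
  have hBp : φ (((-463078 : ℤ) : 𝓞 K) + (158036 : ℤ) * thetaInt (aeval_eq hγ) + (-88849 : ℤ) * thetaInt (delta_root hγ)) = 0 := by simp only [map_add, map_mul, map_intCast, hφγ, hφδ]; exact eB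
  have h2 : φ ((-2 : ℤ) : 𝓞 K) = 1 := by rw [map_intCast]; exact e2
  obtain ⟨r, hr, h⟩ := sq_residue_X_of_local hγ φ (by rw [h2]; exact one_ne_zero) (by rw [hA]; exact one_ne_zero)
    hBp v hv hd hloc
  rw [hA, h2, mul_one, mul_one, or_self] at h
  exact ⟨r, hr, h⟩

/-- **At `𝔮₇ = (7, γ - 6)` (`δ ↦ 2`; `A ↦ 6`, `-2 ↦ 5`, `A·(-2) ↦ 2 = 3²`, `B' ↦ 0`): `φ(d)` is a non-zero square.**
[cite: SilvermanAEC2009, Prop. X.4.9] -/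
theorem sq_residue_q7 (hγ : γ ^ 3 - γ ^ 2 + 27 * γ + 36 = 0) (φ : 𝓞 K →+* ZMod 7)
    (hφγ : φ (thetaInt (aeval_eq hγ)) = 6)
    (v : HeightOneSpectrum (𝓞 K)) (hv : RingHom.ker φ = v.asIdeal) {d : 𝓞 K} (hd : φ d ≠ 0)
    (hloc : sqClass (algebraMap K (v.adicCompletion K) (algebraMap (𝓞 K) K d)) ∈
      Set.range ((⟨0, -73 * γ ^ 2 - 155 * γ - 1238, 0, (88849 * γ ^ 2 - 562957 * γ + 1141719) / 3, 0⟩ : WeierstrassCurve K).baseChange (v.adicCompletion K)).xSqClass) :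
    ∃ r : ZMod 7, r ≠ 0 ∧ φ d = r ^ 2 := by
  have eδ : (5 : ZMod 7) * (6 ^ 2 - 6 + 18) = 2 := by decide
  have eA : ((76 : ℤ) : ZMod 7) + ((-228 : ℤ) : ZMod 7) * 6 + ((-219 : ℤ) : ZMod 7) * 2 = 6 := by decide
  have eB : ((-463078 : ℤ) : ZMod 7) + ((158036 : ℤ) : ZMod 7) * 6 + ((-88849 : ℤ) : ZMod 7) * 2 = 0 := by decide
  have e2 : ((-2 : ℤ) : ZMod 7) = 5 := by decide
  have e50 : (5 : ZMod 7) ≠ 0 := by decide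
  have e60 : (6 : ZMod 7) ≠ 0 := by decide
  have fin : ∀ x r : ZMod 7, r ≠ 0 → (x = r ^ 2 ∨ x * 6 * 5 = r ^ 2) → ∃ r' : ZMod 7, r' ≠ 0 ∧ x = r' ^ 2 := by
    decide
  haveI : Fact (Nat.Prime 7) := ⟨by norm_num⟩
  have hδ : φ (thetaInt (delta_root hγ)) = 2 := by rw [residueHom_seven_delta hγ φ 6 hφγ]; exact eδ
  have hA : φ (((76 : ℤ) : 𝓞 K) + (-228 : ℤ) * thetaInt (aeval_eq hγ) + (-219 : ℤ) * thetaInt (delta_root hγ)) = 6 := by simp only [map_add, map_mul, map_intCast, hφγ, hδ]; exact eA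
  have hBp : φ (((-463078 : ℤ) : 𝓞 K) + (158036 : ℤ) * thetaInt (aeval_eq hγ) + (-88849 : ℤ) * thetaInt (delta_root hγ)) = 0 := by simp only [map_add, map_mul, map_intCast, hφγ, hδ]; exact eB
  have h2 : φ ((-2 : ℤ) : 𝓞 K) = 5 := by rw [map_intCast]; exact e2
  obtain ⟨r, hr, h⟩ := sq_residue_X_of_local hγ φ (by rw [h2]; exact e50) (by rw [hA]; exact e60) hBp v hv hd hloc
  rw [hA, h2] at h
  exact fin _ r hr h

/-- **At `𝔮₂₀₆₉ = (2069, γ - 1583)` (`-A/2 ↦ 1896`, a non-residue, but `ord(B') = 1` is odd): `φ(d)` is a non-zero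
square.** [cite: SilvermanAEC2009, Prop. X.4.9] -/
theorem sq_residue_q2069 (hγ : γ ^ 3 - γ ^ 2 + 27 * γ + 36 = 0) (h3 : finrank ℚ K = 3) (φ : 𝓞 K →+* ZMod 2069)
    (hφγ : φ (thetaInt (aeval_eq hγ)) = 1583)
    (v : HeightOneSpectrum (𝓞 K)) (hv : RingHom.ker φ = v.asIdeal) {d : 𝓞 K} (hd : φ d ≠ 0)
    (hloc : sqClass (algebraMap K (v.adicCompletion K) (algebraMap (𝓞 K) K d)) ∈
      Set.range ((⟨0, -73 * γ ^ 2 - 155 * γ - 1238, 0, (88849 * γ ^ 2 - 562957 * γ + 1141719) / 3, 0⟩ : WeierstrassCurve K).baseChange (v.adicCompletion K)).xSqClass) :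
    ∃ r : ZMod 2069, r ≠ 0 ∧ φ d = r ^ 2 := by
  have eδ : (690 : ZMod 2069) * (1583 ^ 2 - 1583 + 18) = 278 := by decide
  have eA : ((76 : ℤ) : ZMod 2069) + ((-228 : ℤ) : ZMod 2069) * 1583 + ((-219 : ℤ) : ZMod 2069) * 278 = 346 := by decide
  have eA0 : (346 : ZMod 2069) ≠ 0 := by decide
  have eB : ((-463078 : ℤ) : ZMod 2069) + ((158036 : ℤ) : ZMod 2069) * 1583 + ((-88849 : ℤ) : ZMod 2069) * 278 = 0 := by
    decide
  have e20 : ((-2 : ℤ) : ZMod 2069) ≠ 0 := by decide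
  have em1 : ¬ (2 : ℤ) ∣ -1 := by decide
  haveI : Fact (Nat.Prime 2069) := ⟨by norm_num⟩
  have h20 : (2 : K) ≠ 0 := two_ne_zero
  have hδ : φ (thetaInt (delta_root hγ)) = 278 := by rw [residueHom_2069_delta hγ φ 1583 hφγ]; exact eδ
  have hA : φ (((76 : ℤ) : 𝓞 K) + (-228 : ℤ) * thetaInt (aeval_eq hγ) + (-219 : ℤ) * thetaInt (delta_root hγ)) = 346 := by simp only [map_add, map_mul, map_intCast, hφγ, hδ]; exact eA
  have hBp : φ (((-463078 : ℤ) : 𝓞 K) + (158036 : ℤ) * thetaInt (aeval_eq hγ) + (-88849 : ℤ) * thetaInt (delta_root hγ)) = 0 := by simp only [map_add, map_mul, map_intCast, hφγ, hδ]; exact eB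
  have hodd : ¬ (2 : ℤ) ∣ WithZero.log (v.valuation K (algebraMap (𝓞 K) K (((-463078 : ℤ) : 𝓞 K) + (158036 : ℤ) * thetaInt (aeval_eq hγ) + (-88849 : ℤ) * thetaInt (delta_root hγ)))) := by
    rw [log_valuation_q2069_Bp hγ h3 φ hφγ v hv]; exact em1
  have key := residue_sq_of_sqClass_mem_range_node_of_odd φ (ZMod.ringHom_surjective φ) v hv
    (⟨0, -73 * γ ^ 2 - 155 * γ - 1238, 0, (88849 * γ ^ 2 - 562957 * γ + 1141719) / 3, 0⟩ : WeierstrassCurve K)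
    (c := -(-73 * γ ^ 2 - 155 * γ - 1238 : K) / 2)
    (e := (-73 * γ ^ 2 - 155 * γ - 1238 : K) ^ 2 / 4 - (88849 * γ ^ 2 - 562957 * γ + 1141719) / 3)
    (by simp only; field_simp) (by simp only; field_simp; ring) (n := -2)
    (c₀ := (((76 : ℤ) : 𝓞 K) + (-228 : ℤ) * thetaInt (aeval_eq hγ) + (-219 : ℤ) * thetaInt (delta_root hγ)))
    (e₀ := (((-463078 : ℤ) : 𝓞 K) + (158036 : ℤ) * thetaInt (aeval_eq hγ) + (-88849 : ℤ) * thetaInt (delta_root hγ)))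
    (by rw [coe_Aint hγ]; push_cast; field_simp)
    (by rw [coe_Bpint hγ, ← sq_sub_four_mul_eq hγ]; push_cast; field_simp; ring)
    (by rw [← hv, RingHom.mem_ker, map_intCast]; exact e20)
    (by rw [← hv, RingHom.mem_ker, hA]; exact eA0)
    (by rw [← hv, RingHom.mem_ker]; exact hBp)
    hodd (d := d) (by rw [← hv, RingHom.mem_ker]; exact hd) hloc
  obtain ⟨r, hr, h⟩ := key
  exact ⟨r, hr.ne_zero, h⟩

end KubertTate289Cubic

end Literature.NumberTheory.EllipticCurves

end
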